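/-
Copyright (c) 2026 the pub-hodgecm-mathlib formalisation cell (harness21).  Prover seat hodgecm-mathlib-K2E3-p21 (g3), HCML Track B «K2-LIT» (build stream 29),
h413 = `stmt-HodgeConjecture-24833`, line `K2_E3_EllipticInputs`, unit U12 «Characters», socket #11 road (11-SC), letter (SC-an): HARISH-CHANDRA'S THEOREM 20
«cusp-form cancellation», brick (T20-e2) «THE HEIGHT BOOKKEEPING (LEMMAS 54–56) AND THE `A = A⁺ ∪ A⁻` DICHOTOMY» (line lead K2E3-p20 (g3) `CENSUS-Thm20` §4 (T20-e);
split (T20-e) = (T20-e1) CORE + (T20-e2) HEIGHTS, `K2/STATUS.md` 2026-09-04T01:48Z).  2026-09-04.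
-/
import Mathlib.Algebra.Group.Subgroup.Pointwise
import Mathlib.Tactic.Group
import Mathlib.Tactic.Ring
import Mathlib.Tactic.Push
import HarnessLib

/-!
# h413 ∕ Track B «K2-LIT», line `K2_E3_EllipticInputs`, unit U12, road (11-SC), letter (SC-an) — Theorem-20 brick (T20-e2): THE HEIGHT BOOKKEEPING OF
# HARISH-CHANDRA'S CUSP-FORM CANCELLATION (Lemmas 54–56 and the reduction of Lemma 57 to a one-line cusp integral), ABSTRACT GROUP FORM
# (Harish-Chandra 1970, Part VII §8 pp. 80–84)

Cell `pub/hodgecm-mathlib`, crux H413 = `stmt-HodgeConjecture-24833`, route of record `HCCMUnconditional`; chair K2-lead (g0), dealer K2E3-plan (g2), line lead of the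
(SC-an) ∕ Theorem-20 bricks K2E3-p20 (g3).  THEOREMS ONLY (no `def`, no `instance`, no `notation`, no named-fact hypothesis, no `sorry`); PURE GROUP THEORY (no
topology, no measure): imports = three Mathlib modules + HarnessLib; lane `--supports stmt-HodgeConjecture-24833 --as helper`, count-neutral.

THE PRINT [HarishChandra1970, Part VII §8, proof of Theorem 20, pp. 80–84].  With `K₀ ⊂ (N̄ ∩ K₁)(M ∩ K₁)(N ∩ K₁)` Iwahori-factorised, `f ∈ Φ_C` (`Supp f ⊂ CA`,
cusp form along `N` and `N̄`), `K₀(y⁻¹) = K₀ ∩ K₀^{y⁻¹}` and `J(x) = ∫_{K₀(y⁻¹)} f(xyk) dk`: if `J(x) ≠ 0` then `xy = γ a k₀` (`γ ∈ C`, `a ∈ A`, `k₀ ∈ K₀(y⁻¹)`); for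
`a ∈ A⁺` and `k ∈ K₀(y⁻¹)`, `k₀k = n̄₀ m₀ n₀` and `xyk n′ = γ₀ (n₀n′)^a a` with `γ₀ = γ (n̄₀ m₀)^a ∈ C·ω₀`; LEMMA 54 (`‖n′‖ ≤ ‖n′a‖²`: `(C₁A) ∩ N` is BOUNDED), LEMMA 55
(`a⁻¹ n′ a ∈ K₀(y⁻¹)` once `ν(a) ≥ c₁(σ(n′) + σ(y))`: CONTRACTION + the deep ball inside `K₀(y⁻¹)`), LEMMA 56 (`σ(a) ≥ σ(x) − σ(C) − σ(y)` is large when `x ∉ ωZ`)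
⇒ «`f(γ₀(n₀n′)^a) = 0` unless `n₀ n′ ∈ N ∩ K₀(y⁻¹)`», after which LEMMA 57 is the single cusp integral `∫_N f(γ₀ a n₀ · n′) dn′ = 0` and LEMMA 53 a Fubini step —
those two MEASURE-THEORETIC steps are (T20-e1) (`K2E3CuspFormCancellationCore`, K2E3-p14 (g3) ∕ this line); THIS FILE is everything before them, as PURE GROUP ALGEBRA.

ABSTRACT CURRENCY (instantiated at `U(σ,Φ₃)` by (T20-f) from ★ bricks — see «DISCHARGE» below).  A group `G`; HEIGHT BALLS `Ω : ℕ → Set G` with `Ω a · Ω b ⊆ Ω (a+b)` and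
`Ω a⁻¹ = Ω a` (★ p856390 `exists_heightBall_compactExhaustion` (iii)(iv)); a level `K₀ ≤ G` with `K₀ ⊆ Ω 0` (★ p856390 (v) + ★ (T20-c) §4), a sub-level `K′ ≤ K₀` (print's
`K₀(y⁻¹)`) containing a DEEP LEVEL `L j₀ ≤ K′` (★ (T20-c) §3: `K_{|ϖ|^{m+2s}} ≤ K₀ ⊓ K₀^{y^{∓1}}` for `y ∈ Ω s`); subgroups `T, N, N̄, A ≤ G` with BOTH Iwahori orders
`K₀ = (K₀⊓N̄)(K₀⊓T)(K₀⊓N) = (K₀⊓N)(K₀⊓T)(K₀⊓N̄)` (★ `coe_comap_congruenceGL_eq_mul` ∕ ★ (T20-c) `coe_comap_congruenceGL_eq_mul_rev`); `A = A⁺ ∪ A⁻` where `a ∈ A⁺`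
conjugates `K₀ ⊓ N̄` into `K₀` and CONTRACTS `N` quantitatively (`a ∉ Ω h`, `n ∈ N ∩ Ω c`, `j + c ≤ h + 1 ⇒ a⁻¹ n a ∈ L j` — ★ (T20-d) p856527 at rank one), `A⁻` the same
with `N ↔ N̄`; `A` normalises `N`, `N̄` and `a t a⁻¹ ∈ K₀` for `t ∈ K₀ ⊓ T`; LEMMA 54's input `n·a′ ∈ Ω c ⇒ n ∈ Ω (2c)` (`‖a′‖ ≤ ‖n a′‖`, ★ (T20-d)); the SUPPORT
`S ⊆ C·A` of the cusp form (`S = {f ≠ 0}`) with `C ⊆ Ω m_C`.  NOTE: the right-`A`-invariance of `f` is NOT needed here nor in (T20-e1) — print's `(n₀n′)^a` is kept as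
`(γ₀ a)·(n₀ n′)`, so the cusp integral is taken at the base point `γ₀ a n₀`.

* §1 `exists_eq_mul_and_forall_mem_of_contracting` — ONE-SIDED (Lemmas 54–56 for a fixed `a` contracting `V` and expanding `U`): if `xy = γ a k₀` (`γ ∈ C`, `k₀ ∈ K′`),
  `a ∉ Ω h` with `j₀ + 4 m_C ≤ h + 1`, then EVERY `k ∈ K′` has `xy·k = g₀ · u₀` with `u₀ ∈ U` and **`∀ u ∈ U, g₀ u ∈ S → u ∈ K′`** (print: `f(γ₀ (n₀n′)^a) = 0` unless
  `n₀n′ ∈ N ∩ K₀(y⁻¹)`).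
* §2 `mem_heightBall_of_eq_mul_mul_mul` (LEMMA 56's height inequality `σ(x) ≤ σ(C) + σ(a) + σ(y)` in `Ω`-form) and the TRICHOTOMY **`cuspForm_trichotomy_of_not_mem_heightBall`**:
  for `y ∈ Ω s`, `L j₀ ≤ K′ ≤ K₀` and `x ∉ Ω (m_C + (j₀ + 4 m_C) + s)` — print's `1 + σ(x) > c(1+σ(C))(1+σ(y))` with an explicit linear `c` — EITHER `xy·k ∉ S` for all
  `k ∈ K′` (so `J(x) = 0` trivially), OR the §1 conclusion holds along `N`, OR it holds along `N̄`: EXACTLY the hypothesis of (T20-e1)'s core lemma (with `S = {f ≠ 0}`),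
  so THEOREM 20 at rank one = (T20-e2) ∘ (T20-e1).
* §3 `cuspForm_trichotomy_support` — the same read with a function `f : G → β` (`S := {g | f g ≠ 0}`), and `cuspForm_trichotomy_conjLevel` — with `K′ := K₀ ⊓ y⁻¹K₀y`
  (membership `k ∈ K₀ ∧ y k y⁻¹ ∈ K₀`) and `j₀ := m + 2s` fed by the (T20-c)-shaped hypothesis `∀ u ∈ L (m+2s), u ∈ K₀ ∧ y u y⁻¹ ∈ K₀`.

DISCHARGE AT `U(σ,Φ₃)(K)` (for (T20-f); all ★): `Ω` = ★ p856390; `K₀ := K_{|ϖ|^m}`, `L j := K_{|ϖ|^j}` (★ (T20-c)); `T, N := (borelTriple σ J hJ).M, .N`, `N̄ := N.map (conj w₀)`,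
Iwahori ★∕★; `A := T` (p20's (T20-b) ruling `A := torusU`), `A⁺ := {d(α,β,ᾱ⁻¹) : |α| ≥ 1}`, `A⁻ := {|α| ≤ 1}`; contraction + Lemma 54 = ★ (T20-d); `S ⊆ C·T` = ★ (T20-b) §1e.

HONEST LABEL.  HC_CM is proved only modulo the 7 printed citations (2 remaining named inputs: hLiu418 = `stmt-HodgeConjecture-24832`, h413 = `stmt-HodgeConjecture-24833`)
until rung 0 closes; this file is a count-neutral helper (nothing printed is asserted: it is the bookkeeping half of print's proof, abstractly).

## References
* [HarishChandra1970] Harish-Chandra (notes by G. van Dijk), *Harmonic Analysis on Reductive p-adic Groups*, LNM 162 (1970), Part VII §2 p. 70 (Theorem 20), §8 pp. 80–84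
  (Lemmas 53–57).
* [Casselman1995] W. Casselman, *Introduction to the theory of admissible representations of `p`-adic reductive groups* (1995 notes), Prop. 1.4.3–1.4.4 (Iwahori
  factorisation, contraction by dominant torus elements).
-/

set_option autoImplicit false
set_option linter.dupNamespace false  -- the mandated namespace repeats the single-problem summit's segment (`HodgeConjecture.HodgeConjecture`)

open scoped Pointwise

namespace Summit.HodgeConjecture.HodgeConjecture.Cruxes.H413.K2E3CuspFormCancellationHeights

variable {G : Type*} [Group G]

/-! ## §1 One-sided: a fixed `a` contracting `V`, expanding `U` (Lemmas 54–56 ⇒ the vanishing pattern of Lemma 57) -/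

/-- **LEMMAS 54–56, ONE-SIDED.**  Height balls `Ω` (`Ω a·Ω b ⊆ Ω(a+b)`, inversion-stable), `K′ ≤ K₀ ⊆ Ω 0`, a deep level `L j₀ ≤ K′`, support `S ⊆ C·A`, `C ⊆ Ω m_C`,
Lemma 54's input on `U` (`u·a′ ∈ Ω c ⇒ u ∈ Ω 2c`), an Iwahori order `K₀ = (K₀⊓V)(K₀⊓T)(K₀⊓U)`, and an element `a ∈ A` with `a(K₀⊓V)a⁻¹, a(K₀⊓T)a⁻¹ ⊆ K₀`, `aUa⁻¹ ⊆ U`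
and the CONTRACTION `j + c ≤ h + 1 ⇒ a⁻¹(U ∩ Ω c)a ⊆ L j`, where `a ∉ Ω h`, `j₀ + 4m_C ≤ h + 1`.  If `xy = γ a k₀` (`γ ∈ C`, `k₀ ∈ K′`) then for every `k ∈ K′`:
`xy·k = g₀·u₀` with `u₀ ∈ U`, and `g₀ u ∈ S ⇒ u ∈ K′` for all `u ∈ U` — print: `k₀k = n̄₀m₀n₀`, `γ₀ = γ(n̄₀m₀)^a ∈ Ω m_C`, `g₀ = γ₀ a`; if `γ₀ a u ∈ CA` then
`(aua⁻¹)(aa′⁻¹) ∈ γ₀⁻¹C ⊆ Ω 2m_C`, so `aua⁻¹ ∈ Ω 4m_C` (Lemma 54) and `u = a⁻¹(aua⁻¹)a ∈ L j₀ ⊆ K′` (Lemmas 55–56).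
[cite: HarishChandra1970, Part VII §8 Lemmas 54–56 pp. 82–83] [cite: Casselman1995, Prop. 1.4.3–1.4.4] -/
theorem exists_eq_mul_and_forall_mem_of_contracting (Ω : ℕ → Set G)
    (hΩmul : ∀ {a b : ℕ} {g g' : G}, g ∈ Ω a → g' ∈ Ω b → g * g' ∈ Ω (a + b)) (hΩinv : ∀ {a : ℕ} {g : G}, g ∈ Ω a → g⁻¹ ∈ Ω a)
    (K₀ K' T U V A : Subgroup G) (L : ℕ → Subgroup G) (hK₀ : (K₀ : Set G) ⊆ Ω 0) (hK' : K' ≤ K₀) {j₀ : ℕ} (hL : L j₀ ≤ K')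
    (S C : Set G) {mC : ℕ} (hC : C ⊆ Ω mC) (hS : S ⊆ C * (A : Set G))
    (h54 : ∀ u ∈ U, ∀ a' ∈ A, ∀ c : ℕ, u * a' ∈ Ω c → u ∈ Ω (2 * c))
    (hIw : ∀ k ∈ K₀, ∃ v ∈ K₀ ⊓ V, ∃ t ∈ K₀ ⊓ T, ∃ u ∈ K₀ ⊓ U, k = v * t * u)
    {a : G} (haA : a ∈ A) {h : ℕ} (hj : j₀ + 4 * mC ≤ h + 1)
    (hcV : ∀ v ∈ K₀ ⊓ V, a * v * a⁻¹ ∈ K₀) (hcT : ∀ t ∈ K₀ ⊓ T, a * t * a⁻¹ ∈ K₀) (hnormU : ∀ u ∈ U, a * u * a⁻¹ ∈ U)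
    (hcontr : ∀ (c j : ℕ), j + c ≤ h + 1 → ∀ u ∈ U, u ∈ Ω c → a⁻¹ * u * a ∈ L j)
    {z γ k₀ : G} (hγ : γ ∈ C) (hk₀ : k₀ ∈ K') (hz : z = γ * a * k₀) :
    ∀ k ∈ K', ∃ g₀ : G, ∃ u₀ ∈ U, z * k = g₀ * u₀ ∧ ∀ u ∈ U, g₀ * u ∈ S → u ∈ K' := by
  intro k hk
  obtain ⟨v, hv, t, ht, u, hu, hfac⟩ := hIw _ (hK' (K'.mul_mem hk₀ hk))
  refine ⟨γ * (a * (v * t) * a⁻¹) * a, u, (Subgroup.mem_inf.1 hu).2, ?_, ?_⟩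
  · -- `z k = γ a (k₀ k) = γ a v t u = γ (a v t a⁻¹) a u`
    rw [hz, mul_assoc (γ * a) k₀ k, hfac]; group
  · intro u' hu' hS'
    obtain ⟨c', hc', a', ha', heq⟩ := Set.mem_mul.1 (hS hS')
    -- `γ₀ := γ (a v t a⁻¹) ∈ Ω m_C`
    have hvt : a * (v * t) * a⁻¹ ∈ K₀ := by
      have e : a * (v * t) * a⁻¹ = (a * v * a⁻¹) * (a * t * a⁻¹) := by group
      rw [e]; exact K₀.mul_mem (hcV v hv) (hcT t ht)
    have hγ₀ : γ * (a * (v * t) * a⁻¹) ∈ Ω mC := by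
      have h1 := hΩmul (hC hγ) (hK₀ hvt); rwa [add_zero] at h1
    -- `(a u' a⁻¹)(a a'⁻¹) = γ₀⁻¹ c' ∈ Ω 2m_C`
    have hw : a * u' * a⁻¹ ∈ U := hnormU u' hu'
    have hid : (a * u' * a⁻¹) * (a * a'⁻¹) = (γ * (a * (v * t) * a⁻¹))⁻¹ * c' := by
      rw [eq_mul_inv_of_mul_eq heq]; group
    have h2 : (a * u' * a⁻¹) * (a * a'⁻¹) ∈ Ω (mC + mC) := by rw [hid]; exact hΩmul (hΩinv hγ₀) (hC hc')
    -- Lemma 54: `a u' a⁻¹ ∈ Ω 4m_C`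
    have h3 : a * u' * a⁻¹ ∈ Ω (2 * (mC + mC)) := h54 _ hw _ (A.mul_mem haA (A.inv_mem ha')) _ h2
    have e4 : 2 * (mC + mC) = 4 * mC := by ring
    rw [e4] at h3
    -- Lemmas 55–56: contract back into the deep level `L j₀ ≤ K′`
    have h5 : a⁻¹ * (a * u' * a⁻¹) * a ∈ L j₀ := hcontr (4 * mC) j₀ hj _ hw h3
    have e6 : a⁻¹ * (a * u' * a⁻¹) * a = u' := by group
    rw [e6] at h5
    exact hL h5

/-! ## §2 Lemma 56's height inequality and the trichotomy (both signs of `a`) -/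

/-- **LEMMA 56's height inequality in `Ω`-form**: if `x = γ a k y⁻¹` with `γ ∈ Ω m_C`, `a ∈ Ω h`, `k ∈ Ω 0`, `y ∈ Ω s`, then `x ∈ Ω (m_C + h + s)`
(print: `σ(x) ≤ σ(C) + σ(a) + σ(y)`, since `‖k₀‖ = 1`). [cite: HarishChandra1970, Part VII §8 p. 83] -/
theorem mem_heightBall_of_eq_mul_mul_mul (Ω : ℕ → Set G)
    (hΩmul : ∀ {a b : ℕ} {g g' : G}, g ∈ Ω a → g' ∈ Ω b → g * g' ∈ Ω (a + b)) (hΩinv : ∀ {a : ℕ} {g : G}, g ∈ Ω a → g⁻¹ ∈ Ω a)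
    {mC h s : ℕ} {x γ a k y : G} (hγ : γ ∈ Ω mC) (ha : a ∈ Ω h) (hk : k ∈ Ω 0) (hy : y ∈ Ω s) (hx : x = γ * a * k * y⁻¹) :
    x ∈ Ω (mC + h + s) := by
  have h1 := hΩmul (hΩmul (hΩmul hγ ha) hk) (hΩinv hy)
  rw [add_zero] at h1
  rw [hx]; exact h1

/-- **THE TRICHOTOMY BEHIND THEOREM 20 (Lemmas 54–56 for both signs; rank-one shape `𝒫′ = {(B,A), (B̄,A)}`).**  Data: height balls `Ω`; `K′ ≤ K₀ ⊆ Ω 0` with a deep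
level `L j₀ ≤ K′`; `T, N, N̄, A ≤ G` with BOTH Iwahori orders of `K₀`; `A = A⁺ ∪ A⁻`, where `a ∈ A⁺` conjugates `K₀ ⊓ N̄` into `K₀` and contracts `N` (`a ∉ Ω h`,
`j + c ≤ h + 1 ⇒ a⁻¹(N ∩ Ω c)a ⊆ L j`), `A⁻` the same with `N ↔ N̄`; `A` normalises `N`, `N̄` and conjugates `K₀ ⊓ T` into `K₀`; Lemma 54's inputs on `N` and `N̄`; a
«support» `S ⊆ C·A`, `C ⊆ Ω m_C`.  THEN for `y ∈ Ω s` and `x ∉ Ω (m_C + (j₀ + 4m_C) + s)` (print's `x ∉ ω(C, y)`): EITHER `x y k ∉ S` for every `k ∈ K′`, OR every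
`k ∈ K′` has `x y k = g₀ n₀` (`n₀ ∈ N`) with `g₀ n ∈ S ⇒ n ∈ K′` on `N`, OR the same along `N̄` — the hypothesis of the core cancellation lemma (T20-e1) in either case.
Proof: if `x y k₁ ∈ S ⊆ CA` for some `k₁ ∈ K′` then `x y = γ a k₁⁻¹`, `a ∉ Ω (j₀ + 4m_C)` by `mem_heightBall_of_eq_mul_mul_mul`, and §1 applies on the side dictated by
`a ∈ A⁺` or `a ∈ A⁻`. [cite: HarishChandra1970, Part VII §8 pp. 80–84, Lemmas 54–57] [cite: Casselman1995, Prop. 1.4.3–1.4.4] -/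
theorem cuspForm_trichotomy_of_not_mem_heightBall (Ω : ℕ → Set G)
    (hΩmul : ∀ {a b : ℕ} {g g' : G}, g ∈ Ω a → g' ∈ Ω b → g * g' ∈ Ω (a + b)) (hΩinv : ∀ {a : ℕ} {g : G}, g ∈ Ω a → g⁻¹ ∈ Ω a)
    (K₀ K' T N Nbar A : Subgroup G) (Aplus Aminus : Set G) (L : ℕ → Subgroup G)
    (hK₀ : (K₀ : Set G) ⊆ Ω 0) (hK' : K' ≤ K₀) {j₀ : ℕ} (hL : L j₀ ≤ K')
    (S C : Set G) {mC : ℕ} (hC : C ⊆ Ω mC) (hS : S ⊆ C * (A : Set G))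
    (hAcover : ∀ a ∈ A, a ∈ Aplus ∨ a ∈ Aminus)
    (hIw : ∀ k ∈ K₀, ∃ v ∈ K₀ ⊓ Nbar, ∃ t ∈ K₀ ⊓ T, ∃ u ∈ K₀ ⊓ N, k = v * t * u)
    (hIw' : ∀ k ∈ K₀, ∃ u ∈ K₀ ⊓ N, ∃ t ∈ K₀ ⊓ T, ∃ v ∈ K₀ ⊓ Nbar, k = u * t * v)
    (hT : ∀ a ∈ A, ∀ t ∈ K₀ ⊓ T, a * t * a⁻¹ ∈ K₀)
    (hnormN : ∀ a ∈ A, ∀ n ∈ N, a * n * a⁻¹ ∈ N) (hnormNbar : ∀ a ∈ A, ∀ v ∈ Nbar, a * v * a⁻¹ ∈ Nbar)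
    (h54N : ∀ n ∈ N, ∀ a' ∈ A, ∀ c : ℕ, n * a' ∈ Ω c → n ∈ Ω (2 * c))
    (h54Nbar : ∀ v ∈ Nbar, ∀ a' ∈ A, ∀ c : ℕ, v * a' ∈ Ω c → v ∈ Ω (2 * c))
    (hplusV : ∀ a ∈ Aplus, ∀ v ∈ K₀ ⊓ Nbar, a * v * a⁻¹ ∈ K₀)
    (hplusC : ∀ a ∈ Aplus, ∀ (h c j : ℕ), a ∉ Ω h → j + c ≤ h + 1 → ∀ n ∈ N, n ∈ Ω c → a⁻¹ * n * a ∈ L j)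
    (hminusV : ∀ a ∈ Aminus, ∀ u ∈ K₀ ⊓ N, a * u * a⁻¹ ∈ K₀)
    (hminusC : ∀ a ∈ Aminus, ∀ (h c j : ℕ), a ∉ Ω h → j + c ≤ h + 1 → ∀ v ∈ Nbar, v ∈ Ω c → a⁻¹ * v * a ∈ L j)
    {s : ℕ} {x y : G} (hy : y ∈ Ω s) (hx : x ∉ Ω (mC + (j₀ + 4 * mC) + s)) :
    (∀ k ∈ K', x * y * k ∉ S) ∨
      (∀ k ∈ K', ∃ g₀ : G, ∃ n₀ ∈ N, x * y * k = g₀ * n₀ ∧ ∀ n ∈ N, g₀ * n ∈ S → n ∈ K') ∨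
      (∀ k ∈ K', ∃ g₀ : G, ∃ v₀ ∈ Nbar, x * y * k = g₀ * v₀ ∧ ∀ v ∈ Nbar, g₀ * v ∈ S → v ∈ K') := by
  by_cases h0 : ∀ k ∈ K', x * y * k ∉ S
  · exact Or.inl h0
  push Not at h0
  obtain ⟨k₁, hk₁, hk₁S⟩ := h0
  obtain ⟨γ, hγ, a, ha, heq⟩ := Set.mem_mul.1 (hS hk₁S)
  -- `x y = γ a k₁⁻¹`, `k₀ := k₁⁻¹ ∈ K′`
  have hz : x * y = γ * a * k₁⁻¹ := by rw [heq]; group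
  have hk₀ : k₁⁻¹ ∈ K' := K'.inv_mem hk₁
  -- Lemma 56: `a ∉ Ω (j₀ + 4 m_C)`
  have hah : a ∉ Ω (j₀ + 4 * mC) := by
    intro hah
    exact hx (mem_heightBall_of_eq_mul_mul_mul Ω hΩmul hΩinv (hC hγ) hah (hK₀ (hK' hk₀)) hy (by rw [← hz]; group))
  rcases hAcover a ha with hap | ham
  · exact Or.inr (Or.inl (exists_eq_mul_and_forall_mem_of_contracting Ω hΩmul hΩinv K₀ K' T N Nbar A L hK₀ hK' hL S C hC hS h54N hIw ha
      (Nat.le_succ _) (hplusV a hap) (hT a ha) (hnormN a ha) (fun c j hcj n hn hnc => hplusC a hap _ c j hah hcj n hn hnc) hγ hk₀ hz))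
  · exact Or.inr (Or.inr (exists_eq_mul_and_forall_mem_of_contracting Ω hΩmul hΩinv K₀ K' T Nbar N A L hK₀ hK' hL S C hC hS h54Nbar hIw' ha
      (Nat.le_succ _) (hminusV a ham) (hT a ha) (hnormNbar a ha) (fun c j hcj v hv hvc => hminusC a ham _ c j hah hcj v hv hvc) hγ hk₀ hz))

/-! ## §3 Readings: a function's support, and the conjugate level `K′ = K₀ ∩ y⁻¹K₀y` -/

/-- **THE TRICHOTOMY FOR A FUNCTION** `f : G → β` (`S := {f ≠ 0}` with `supp f ⊆ C·A`): under the data of `cuspForm_trichotomy_of_not_mem_heightBall`, for `y ∈ Ω s` and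
`x ∉ Ω (m_C + (j₀ + 4m_C) + s)`: `f(x y k) = 0` for all `k ∈ K′`, OR every `k ∈ K′` has `x y k = g₀ n₀` (`n₀ ∈ N`) with `f(g₀ n) ≠ 0 ⇒ n ∈ K′`, OR the same along `N̄`.
[cite: HarishChandra1970, Part VII §8 pp. 80–84, Lemmas 54–57] -/
theorem cuspForm_trichotomy_support {β : Type*} [Zero β] (Ω : ℕ → Set G)
    (hΩmul : ∀ {a b : ℕ} {g g' : G}, g ∈ Ω a → g' ∈ Ω b → g * g' ∈ Ω (a + b)) (hΩinv : ∀ {a : ℕ} {g : G}, g ∈ Ω a → g⁻¹ ∈ Ω a)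
    (K₀ K' T N Nbar A : Subgroup G) (Aplus Aminus : Set G) (L : ℕ → Subgroup G)
    (hK₀ : (K₀ : Set G) ⊆ Ω 0) (hK' : K' ≤ K₀) {j₀ : ℕ} (hL : L j₀ ≤ K')
    (f : G → β) (C : Set G) {mC : ℕ} (hC : C ⊆ Ω mC) (hsupp : ∀ g, f g ≠ 0 → g ∈ C * (A : Set G))
    (hAcover : ∀ a ∈ A, a ∈ Aplus ∨ a ∈ Aminus)
    (hIw : ∀ k ∈ K₀, ∃ v ∈ K₀ ⊓ Nbar, ∃ t ∈ K₀ ⊓ T, ∃ u ∈ K₀ ⊓ N, k = v * t * u)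
    (hIw' : ∀ k ∈ K₀, ∃ u ∈ K₀ ⊓ N, ∃ t ∈ K₀ ⊓ T, ∃ v ∈ K₀ ⊓ Nbar, k = u * t * v)
    (hT : ∀ a ∈ A, ∀ t ∈ K₀ ⊓ T, a * t * a⁻¹ ∈ K₀)
    (hnormN : ∀ a ∈ A, ∀ n ∈ N, a * n * a⁻¹ ∈ N) (hnormNbar : ∀ a ∈ A, ∀ v ∈ Nbar, a * v * a⁻¹ ∈ Nbar)
    (h54N : ∀ n ∈ N, ∀ a' ∈ A, ∀ c : ℕ, n * a' ∈ Ω c → n ∈ Ω (2 * c))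
    (h54Nbar : ∀ v ∈ Nbar, ∀ a' ∈ A, ∀ c : ℕ, v * a' ∈ Ω c → v ∈ Ω (2 * c))
    (hplusV : ∀ a ∈ Aplus, ∀ v ∈ K₀ ⊓ Nbar, a * v * a⁻¹ ∈ K₀)
    (hplusC : ∀ a ∈ Aplus, ∀ (h c j : ℕ), a ∉ Ω h → j + c ≤ h + 1 → ∀ n ∈ N, n ∈ Ω c → a⁻¹ * n * a ∈ L j)
    (hminusV : ∀ a ∈ Aminus, ∀ u ∈ K₀ ⊓ N, a * u * a⁻¹ ∈ K₀)
    (hminusC : ∀ a ∈ Aminus, ∀ (h c j : ℕ), a ∉ Ω h → j + c ≤ h + 1 → ∀ v ∈ Nbar, v ∈ Ω c → a⁻¹ * v * a ∈ L j)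
    {s : ℕ} {x y : G} (hy : y ∈ Ω s) (hx : x ∉ Ω (mC + (j₀ + 4 * mC) + s)) :
    (∀ k ∈ K', f (x * y * k) = 0) ∨
      (∀ k ∈ K', ∃ g₀ : G, ∃ n₀ ∈ N, x * y * k = g₀ * n₀ ∧ ∀ n ∈ N, f (g₀ * n) ≠ 0 → n ∈ K') ∨
      (∀ k ∈ K', ∃ g₀ : G, ∃ v₀ ∈ Nbar, x * y * k = g₀ * v₀ ∧ ∀ v ∈ Nbar, f (g₀ * v) ≠ 0 → v ∈ K') := by
  have hS : {g | f g ≠ 0} ⊆ C * (A : Set G) := fun g hg => hsupp g hg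
  rcases cuspForm_trichotomy_of_not_mem_heightBall Ω hΩmul hΩinv K₀ K' T N Nbar A Aplus Aminus L hK₀ hK' hL {g | f g ≠ 0} C hC hS hAcover hIw hIw' hT
      hnormN hnormNbar h54N h54Nbar hplusV hplusC hminusV hminusC hy hx with h | h | h
  · exact Or.inl fun k hk => by simpa using h k hk
  · exact Or.inr (Or.inl h)
  · exact Or.inr (Or.inr h)

/-- **THE TRICHOTOMY AT THE CONJUGATE LEVEL `K′ = K₀(y⁻¹) = K₀ ∩ y⁻¹K₀y`** (membership `k ∈ K₀ ∧ y k y⁻¹ ∈ K₀`), with the deep index `j₀ := m + 2s` fed by the (T20-c)-shaped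
containment «`y ∈ Ω s ⇒ ∀ u ∈ L (m+2s), u ∈ K₀ ∧ y u y⁻¹ ∈ K₀`» (★ `K2E3IwahoriFactorisedLevelU3.conj_mem_comap_congruenceGL_of_heightBall`): for `y ∈ Ω s` and
`x ∉ Ω (m_C + (m + 2s + 4m_C) + s)`, the three cases of `cuspForm_trichotomy_support` hold with this `K′` — the exact input of (T20-e1) for
`J(x) = ∫_{K₀(y⁻¹)} f(xyk) dk`. [cite: HarishChandra1970, Part VII §8 pp. 80–84, Lemmas 53–57] -/
theorem cuspForm_trichotomy_conjLevel {β : Type*} [Zero β] (Ω : ℕ → Set G)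
    (hΩmul : ∀ {a b : ℕ} {g g' : G}, g ∈ Ω a → g' ∈ Ω b → g * g' ∈ Ω (a + b)) (hΩinv : ∀ {a : ℕ} {g : G}, g ∈ Ω a → g⁻¹ ∈ Ω a)
    (K₀ K' T N Nbar A : Subgroup G) (Aplus Aminus : Set G) (L : ℕ → Subgroup G)
    (hK₀ : (K₀ : Set G) ⊆ Ω 0) {m s : ℕ} {y : G} (hy : y ∈ Ω s)
    (hK' : ∀ k, k ∈ K' ↔ k ∈ K₀ ∧ y * k * y⁻¹ ∈ K₀)
    (hdeep : ∀ u ∈ L (m + 2 * s), u ∈ K₀ ∧ y * u * y⁻¹ ∈ K₀)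
    (f : G → β) (C : Set G) {mC : ℕ} (hC : C ⊆ Ω mC) (hsupp : ∀ g, f g ≠ 0 → g ∈ C * (A : Set G))
    (hAcover : ∀ a ∈ A, a ∈ Aplus ∨ a ∈ Aminus)
    (hIw : ∀ k ∈ K₀, ∃ v ∈ K₀ ⊓ Nbar, ∃ t ∈ K₀ ⊓ T, ∃ u ∈ K₀ ⊓ N, k = v * t * u)
    (hIw' : ∀ k ∈ K₀, ∃ u ∈ K₀ ⊓ N, ∃ t ∈ K₀ ⊓ T, ∃ v ∈ K₀ ⊓ Nbar, k = u * t * v)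
    (hT : ∀ a ∈ A, ∀ t ∈ K₀ ⊓ T, a * t * a⁻¹ ∈ K₀)
    (hnormN : ∀ a ∈ A, ∀ n ∈ N, a * n * a⁻¹ ∈ N) (hnormNbar : ∀ a ∈ A, ∀ v ∈ Nbar, a * v * a⁻¹ ∈ Nbar)
    (h54N : ∀ n ∈ N, ∀ a' ∈ A, ∀ c : ℕ, n * a' ∈ Ω c → n ∈ Ω (2 * c))
    (h54Nbar : ∀ v ∈ Nbar, ∀ a' ∈ A, ∀ c : ℕ, v * a' ∈ Ω c → v ∈ Ω (2 * c))
    (hplusV : ∀ a ∈ Aplus, ∀ v ∈ K₀ ⊓ Nbar, a * v * a⁻¹ ∈ K₀)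
    (hplusC : ∀ a ∈ Aplus, ∀ (h c j : ℕ), a ∉ Ω h → j + c ≤ h + 1 → ∀ n ∈ N, n ∈ Ω c → a⁻¹ * n * a ∈ L j)
    (hminusV : ∀ a ∈ Aminus, ∀ u ∈ K₀ ⊓ N, a * u * a⁻¹ ∈ K₀)
    (hminusC : ∀ a ∈ Aminus, ∀ (h c j : ℕ), a ∉ Ω h → j + c ≤ h + 1 → ∀ v ∈ Nbar, v ∈ Ω c → a⁻¹ * v * a ∈ L j)
    {x : G} (hx : x ∉ Ω (mC + (m + 2 * s + 4 * mC) + s)) :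
    (∀ k ∈ K', f (x * y * k) = 0) ∨
      (∀ k ∈ K', ∃ g₀ : G, ∃ n₀ ∈ N, x * y * k = g₀ * n₀ ∧ ∀ n ∈ N, f (g₀ * n) ≠ 0 → n ∈ K') ∨
      (∀ k ∈ K', ∃ g₀ : G, ∃ v₀ ∈ Nbar, x * y * k = g₀ * v₀ ∧ ∀ v ∈ Nbar, f (g₀ * v) ≠ 0 → v ∈ K') := by
  have hK'le : K' ≤ K₀ := fun k hk => ((hK' k).1 hk).1
  have hL : L (m + 2 * s) ≤ K' := fun u hu => (hK' u).2 (hdeep u hu)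
  exact cuspForm_trichotomy_support Ω hΩmul hΩinv K₀ K' T N Nbar A Aplus Aminus L hK₀ hK'le hL f C hC hsupp hAcover hIw hIw' hT hnormN hnormNbar
    h54N h54Nbar hplusV hplusC hminusV hminusC hy hx

end Summit.HodgeConjecture.HodgeConjecture.Cruxes.H413.K2E3CuspFormCancellationHeights
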